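import Literature.Computability.Cryptography.LWESelfTestSamplerProg
import Literature.Computability.Cryptography.LWEGuessTestLayout
import Literature.Computability.Cryptography.LWEDistinguisherTransport
import HarnessLib

/-!
# The raising and padding transformations of BLPRS's Thm. 4.1 as typed polynomial-time programs, and their laws on uniform coins

Topic `Computability/Cryptography` (LWE), grouping namespace `BLPRS2013.KProg`; sequel of `LWESelfTestSamplerProg.lean` (the `Ψ̄` sampler program `psiFlat`/`psiOf`
inside item arithmetic) and program-level companion of `LWEDistinguisherTransport.lean` (`raiseThen χ' M D`: add fresh noise `e'ᵢ ← χ'` to every `bᵢ`, then run `D`;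
`padThen h D`: run `D` on the first `m₁` samples). The candidate vector of `BLPRSSection4AssemblyExplicit.candVec` applies exactly these two transformations to the input
tuple before the candidates proper. This file writes them on item lists (everything PROVED; definitions with bodies; no named fact):

* `raiseFlat Q PG κ̂ b items coins` (item `i` gets `bᵢ + Ψ̄-sample from the i-th chunk of width coinLen`), `RaiseRec`/`raiseOf` (program), `raiseOf_eq`,
  **`raiseOf_codeFP`**, **`uniformVector_map_raiseFlat`** (`= (iidPMF (psiLaw …) M).map (e ↦ items of (addNoiseSample (S i) (e i))ᵢ)` for `M·coinLen ≤ C`);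
* `padFlat m₁ items = items.take m₁`, `padFlat_ofFn` (`= items of (S ∘ Fin.castLE h)`), `padFlat_codeFP`.

## References

* Z. Brakerski, A. Langlois, C. Peikert, O. Regev, D. Stehlé, *Classical hardness of learning with errors*, STOC 2013; arXiv:1306.0281, Thm. 4.1 (proof, p. 17:
  "adding fresh noise"; p. 13: the sample counts) and §5. [BrakerskiEtAl2013]
* S. Arora, B. Barak, *Computational Complexity: A Modern Approach*, CUP 2009, §1.3, Def. 7.1. [AroraBarak2009]
-/

noncomputable section

open scoped ENNReal
open PMF Literature.Probability.Distributions Literature.Algebra.EuclideanLattices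

namespace Literature.Computability.Cryptography

namespace BLPRS2013

namespace KProg

open Literature.Computability.Complexity Literature.Computability.Complexity.CodeFP Literature.Computability.QuantumComplexity
  GaussRejMachine LWE LWE.MP12 LWE.MP12.Prog
open Literature.Algebra.EuclideanLattices (encodeRat encodeRat_injective)

/-! ### Raising: add a fresh `Ψ̄` sample to every `b` -/

/-- **Raise one item**: `(a, (b + e) mod Q)` with `e` the `Ψ̄` sampler's value on the item's coins. [cite: BrakerskiEtAl2013, Thm. 4.1 (proof, p. 17)] -/
def raiseItem (Q : ℕ) (κh : ℚ) (b : ℕ) (PG : PGParams) (it : LItem) (coins : List Bool) : LItem :=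
  (it.1, (it.2 + psiFlat Q κh b PG coins) % Q)

/-- **Raise an item list**: item `i` with the `i`-th chunk of width `coinLen`. [cite: BrakerskiEtAl2013, Thm. 4.1 (proof, p. 17)] -/
def raiseFlat (Q : ℕ) (κh : ℚ) (b : ℕ) (PG : PGParams) (items : List LItem) (coins : List Bool) : List LItem :=
  List.zipWith (raiseItem Q κh b PG) items ((List.range items.length).map fun i => (coins.drop (i * PG.coinLen)).take PG.coinLen)

/-- **The raising program against the `Ψ̄` sampler's record** (`PRec = ((Q, (κ̂, b)), (ctx, coinLen))`). [cite: BrakerskiEtAl2013, §5] -/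
def raiseOf (r : PRec) (x : List LItem × List Bool) : List LItem :=
  List.zipWith (fun it ch => (it.1, (it.2 + psiOf r ch) % r.1.1)) x.1 ((List.range x.1.length).map fun i => (x.2.drop (i * r.2.2)).take r.2.2)

/-- At the genuine record the program is the closed form. [folklore] -/
theorem raiseOf_eq (Q : ℕ) (κh : ℚ) (b : ℕ) (PG : PGParams) (items : List LItem) (coins : List Bool) :
    raiseOf (pRecOf Q κh b PG) (items, coins) = raiseFlat Q κh b PG items coins := by
  unfold raiseOf raiseFlat raiseItem
  simp only [psiOf_pRecOf]
  rfl

/-- **The raising program is typed polynomial time** in `(record, (items, coins))`. [cite: BrakerskiEtAl2013, §5; AroraBarak2009, §1.3] -/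
theorem raiseOf_codeFP : CodeFP (pairE pRecE (pairE (rawE itemRawE) strE)) (rawE itemRawE) (fun p => raiseOf p.1 p.2) := by
  have hr : CodeFP (pairE pRecE (pairE (rawE itemRawE) strE)) pRecE (fun p => p.1) := fst _ _
  have hits : CodeFP (pairE pRecE (pairE (rawE itemRawE) strE)) (rawE itemRawE) (fun p => p.2.1) := (snd _ _).fst'
  have hc : CodeFP (pairE pRecE (pairE (rawE itemRawE) strE)) strE (fun p => p.2.2) := (snd _ _).snd'
  have hlen : CodeFP (pairE pRecE (pairE (rawE itemRawE) strE)) unE (fun p => p.1.2.2) := hr.snd'.snd'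
  have hm : CodeFP (pairE pRecE (pairE (rawE itemRawE) strE)) unE (fun p => p.2.1.length) := ((ulength _).comp hits :)
  have hchunks : CodeFP (pairE pRecE (pairE (rawE itemRawE) strE)) (rawE strE)
      (fun p => (List.range p.2.1.length).map fun i => (p.2.2.drop (i * p.1.2.2)).take p.1.2.2) :=
    (strChunks.comp (hm.pair (hlen.pair hc)) :)
  -- one item, with the record as context
  have hQ : CodeFP (pairE pRecE (pairE itemRawE strE)) natE (fun t => t.1.1.1) := (fst _ _).fst'.fst'
  have hit : CodeFP (pairE pRecE (pairE itemRawE strE)) itemRawE (fun t => t.2.1) := (snd _ _).fst'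
  have hch : CodeFP (pairE pRecE (pairE itemRawE strE)) strE (fun t => t.2.2) := (snd _ _).snd'
  have he : CodeFP (pairE pRecE (pairE itemRawE strE)) natE (fun t => psiOf t.1 t.2.2) := (psiOf_codeFP.comp ((fst _ _).pair hch) :)
  have hstep : CodeFP (pairE pRecE (pairE itemRawE strE)) itemRawE (fun t => (t.2.1.1, (t.2.1.2 + psiOf t.1 t.2.2) % t.1.1.1)) :=
    (hit.fst'.pair (natMod.comp ((natAdd.comp (hit.snd'.pair he)).pair hQ)) :)
  exact (((zipWith hstep).comp (hr.pair (hits.pair hchunks))).congr fun p => rfl)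

/-! ### Padding: the first `m₁` items -/

/-- **Pad**: keep the first `m₁` items. [cite: BrakerskiEtAl2013, p. 13 (the sample counts)] -/
def padFlat (m₁ : ℕ) (items : List LItem) : List LItem := items.take m₁

/-- Padding is typed polynomial time in `(m₁ (unary), items)`. [cite: AroraBarak2009, §1.3] -/
theorem padFlat_codeFP : CodeFP (pairE unE (rawE itemRawE)) (rawE itemRawE) (fun p => padFlat p.1 p.2) := rawTakeUn itemRawE

/-- **Padding the item list of a tuple is the item list of its restriction** (`padThen`'s input map). [folklore] -/
theorem padFlat_ofFn {d Q m₁ m₂ : ℕ} (h : m₁ ≤ m₂) (S : Fin m₂ → (Fin d → ZMod Q) × ZMod Q) :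
    padFlat m₁ (List.ofFn fun i => toItem (S i)) = List.ofFn fun i : Fin m₁ => toItem (S (Fin.castLE h i)) := by
  unfold padFlat
  have := take_drop_ofFn (fun i => toItem (S i)) 0 m₁ (by omega)
  rw [List.drop_zero] at this
  rw [this]
  congr 1
  funext k
  congr 2
  exact Fin.ext (by simp)

/-! ### The law of raising on uniform coins -/

section Law

variable {Q : ℕ} [NeZero Q] {d : ℕ}

/-- **Raising one item adds the `Ψ̄` sample to `b`**: `raiseItem (toItem x) coins = toItem (addNoiseSample x e)` with `e` the sampler's residue. [folklore] -/
theorem raiseItem_toItem (κh : ℚ) (b : ℕ) (PG : PGParams) (x : (Fin d → ZMod Q) × ZMod Q) (coins : List Bool) :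
    raiseItem Q κh b PG (toItem x) coins = toItem (addNoiseSample x ((psiFlat Q κh b PG coins : ℕ) : ZMod Q)) := by
  unfold raiseItem toItem addNoiseSample
  simp only [Prod.mk.injEq, true_and]
  rw [ZMod.val_add, ZMod.val_natCast, Nat.add_mod_mod]

/-- **On uniform coins the raising program adds iid `psiLaw` noise** (read through `toItem`), for coin strings of length `C ≥ M·coinLen`.
[cite: BrakerskiEtAl2013, Thm. 4.1 (proof, p. 17); AroraBarak2009, Def. 7.1] -/
theorem uniformVector_map_raiseFlat (κh : ℚ) (b : ℕ) (PG : PGParams) {M : ℕ} (S : Fin M → (Fin d → ZMod Q) × ZMod Q) {C : ℕ} (hC : PG.coinLen * M ≤ C) :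
    (uniformOfFintype (List.Vector Bool C)).map (fun v => raiseFlat Q κh b PG (List.ofFn fun i => toItem (S i)) v.toList) =
      (iidPMF (psiLaw Q (κh : ℝ) b PG.lawPMF) M).map fun e => List.ofFn fun i => toItem (addNoiseSample (S i) (e i)) := by
  classical
  have hfac : (fun v : List.Vector Bool C => raiseFlat Q κh b PG (List.ofFn fun i => toItem (S i)) v.toList) =
      List.ofFn ∘ (fun (c : Fin M → List.Vector Bool PG.coinLen) (i : Fin M) => raiseItem Q κh b PG (toItem (S i)) (c i).toList) ∘ chunks PG.coinLen M hC := by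
    funext v
    simp only [Function.comp_apply, raiseFlat, List.length_ofFn, chunkList_eq_ofFn, zipWith_ofFn_ofFn]
    rfl
  rw [hfac, ← PMF.map_comp, ← PMF.map_comp, uniformVector_map_chunks_eq_indepLaw,
    indepLaw_map_pi M _ (fun (i : Fin M) (c : List.Vector Bool PG.coinLen) => raiseItem Q κh b PG (toItem (S i)) c.toList)]
  -- each coordinate: the sampler's residue, cast
  have hcoord : ∀ i : Fin M, (uniformOfFintype (List.Vector Bool PG.coinLen)).map (fun c => raiseItem Q κh b PG (toItem (S i)) c.toList) =
      (psiLaw Q (κh : ℝ) b PG.lawPMF).map fun e => toItem (addNoiseSample (S i) e) := by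
    intro i
    simp_rw [raiseItem_toItem]
    rw [show (fun c : List.Vector Bool PG.coinLen => toItem (addNoiseSample (S i) ((psiFlat Q κh b PG c.toList : ℕ) : ZMod Q))) =
        (fun e : ZMod Q => toItem (addNoiseSample (S i) e)) ∘ (fun k : ℕ => (k : ZMod Q)) ∘ (fun c : List.Vector Bool PG.coinLen => psiFlat Q κh b PG c.toList)
        from rfl, ← PMF.map_comp, ← PMF.map_comp, uniformVector_map_psiFlat Q κh b PG le_rfl, PMF.map_comp, PMF.map_comp]
    congr 1
    funext e
    simp
  simp_rw [hcoord]
  rw [show (fun i : Fin M => (psiLaw Q (κh : ℝ) b PG.lawPMF).map fun e => toItem (addNoiseSample (S i) e)) =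
      (fun i : Fin M => ((fun _ : Fin M => psiLaw Q (κh : ℝ) b PG.lawPMF) i).map ((fun i e => toItem (d := d) (Q := Q) (addNoiseSample (S i) e)) i)) from rfl,
    ← indepLaw_map_pi M (fun _ => psiLaw Q (κh : ℝ) b PG.lawPMF) (fun i e => toItem (d := d) (Q := Q) (addNoiseSample (S i) e)), indepLaw_const,
    PMF.map_comp]
  rfl

end Law

end KProg

end BLPRS2013

end Literature.Computability.Cryptography

end
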